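import Mathlib
import Literature.LinearAlgebra.Matrix.BipartiteForestMatrix

/-!
# The doubled (bipartite) matrix: determinant at `y = z = 0` and the two peeling recursions

Continuation of `Literature/LinearAlgebra/Matrix/BipartiteForestMatrix.lean` (same set-up and
notation: arc weights `a`, vertex set `D`, `P = L_D + D_ℓ`, doubled matrix
`N = [[D_y, Pᵀ], [P, D_z]]` on the fixed index type `V ⊕ V`).  Here:
* `det_bigN_zero_zero` — at `y = z = 0`, `det N = det P` (row permutation to a block triangular
  matrix, `x² = x` in `𝔽₂`) [Smith2016CongruentDensity, §2.1, the constant term of Prop. 2.4];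
* `det_bigN_rec` — peeling the ROOT copy `inr s` of a vertex: Smith's involution remark
  (`det_eq_peel_of_decomp`) applied to row `inr s = z s e_{inr s} + ℓ s e_{inl s} +
  Σ_j a s j (e_{inl j} + e_{inl s})`, the unit border evaluated as a principal minor and the borders
  `e_{inl j} + e_{inl s}` CONTRACTED (`contract_bigN`): a deletion–contraction recursion in the
  spirit of the inductive proof of the all minors matrix tree theorem [Chaiken1982, §2];
* `det_unitize_bigN_rec` — peeling the MARK copy `inl s` of an unweighted root.
These two recursions drive the induction of `BipartiteForestFormula.lean`.
-/

namespace Literature.LinearAlgebra.Matrix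

open _root_.Matrix Finset

variable {V : Type*} [Fintype V] [DecidableEq V]

/-- The row permutation exchanging the two copies `inl i ↔ inr i` of every `i ∈ D`.
[cite: Smith2016CongruentDensity, §2.1 (chunk p0006 L48: det M at z = 0 via the singular A)] -/
def swapCopies (D : Finset V) : Equiv.Perm (V ⊕ V) where
  toFun := fun x => match x with
    | Sum.inl i => if i ∈ D then Sum.inr i else Sum.inl i
    | Sum.inr i => if i ∈ D then Sum.inl i else Sum.inr i
  invFun := fun x => match x with
    | Sum.inl i => if i ∈ D then Sum.inr i else Sum.inl i
    | Sum.inr i => if i ∈ D then Sum.inl i else Sum.inr i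
  left_inv := by
    rintro (i | i) <;> by_cases hi : i ∈ D <;> simp [hi]
  right_inv := by
    rintro (i | i) <;> by_cases hi : i ∈ D <;> simp [hi]

set_option linter.unusedSimpArgs false in -- shared simp sets across case splits
omit [Fintype V] in
/-- At `y = z = 0` the doubled matrix, after exchanging the two copies of every vertex of `D`, is
block lower-triangular `[[P̃, 0], [0, P̃ᵀ]]` with `P̃ = lap a D ℓ`.
[cite: Smith2016CongruentDensity, §2.1 (chunk p0006 L48)] -/
theorem bigN_zero_zero_submatrix (a : V → V → ZMod 2) (D : Finset V) (ℓ : V → ZMod 2) :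
    (bigN a D 0 0 ℓ).submatrix (swapCopies D) id =
      fromBlocks (lap a D ℓ) 0 0 (lap a D ℓ)ᵀ := by
  ext (i | i) (k | k)
  · rw [submatrix_apply, id_eq, fromBlocks_apply₁₁, lap_apply]
    by_cases hi : i ∈ D
    · have h1 : swapCopies D (Sum.inl i) = Sum.inr i := by simp [swapCopies, hi]
      rw [h1, bigN_inr_inl, lapIn_apply]
      by_cases hk : k ∈ D
      · simp [hi, hk]
      · have hik : i ≠ k := fun h => hk (h ▸ hi)
        simp [hi, hk, hik]
    · have h1 : swapCopies D (Sum.inl i) = Sum.inl i := by simp [swapCopies, hi]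
      rw [h1, bigN_inl_inl]
      by_cases hik : i = k
      · subst hik; simp [hi]
      · simp [hik, hi]
  · rw [submatrix_apply, id_eq, fromBlocks_apply₁₂, Matrix.zero_apply]
    by_cases hi : i ∈ D
    · have h1 : swapCopies D (Sum.inl i) = Sum.inr i := by simp [swapCopies, hi]
      rw [h1, bigN_inr_inr]
      by_cases hik : i = k
      · subst hik; simp [hi]
      · simp [hik, hi]
    · have h1 : swapCopies D (Sum.inl i) = Sum.inl i := by simp [swapCopies, hi]
      rw [h1, bigN_inl_inr, lapIn_apply]
      simp [hi]
  · rw [submatrix_apply, id_eq, fromBlocks_apply₂₁, Matrix.zero_apply]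
    by_cases hi : i ∈ D
    · have h1 : swapCopies D (Sum.inr i) = Sum.inl i := by simp [swapCopies, hi]
      rw [h1, bigN_inl_inl]
      by_cases hik : i = k
      · subst hik; simp [hi]
      · simp [hik, hi]
    · have h1 : swapCopies D (Sum.inr i) = Sum.inr i := by simp [swapCopies, hi]
      rw [h1, bigN_inr_inl, lapIn_apply]
      simp [hi]
  · rw [submatrix_apply, id_eq, fromBlocks_apply₂₂, transpose_apply, lap_apply]
    by_cases hi : i ∈ D
    · have h1 : swapCopies D (Sum.inr i) = Sum.inl i := by simp [swapCopies, hi]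
      rw [h1, bigN_inl_inr, lapIn_apply]
      by_cases hk : k ∈ D
      · by_cases hki : k = i
        · subst hki; simp [hi]
        · simp [hi, hk, hki, Ne.symm hki]
      · have hki : k ≠ i := fun h => hk (h ▸ hi)
        simp [hi, hk, hki, Ne.symm hki]
    · have h1 : swapCopies D (Sum.inr i) = Sum.inr i := by simp [swapCopies, hi]
      rw [h1, bigN_inr_inr]
      by_cases hik : i = k
      · subst hik; simp [hi]
      · simp [hik, Ne.symm hik, hi]

/-- **At `y = z = 0` the determinant of the doubled matrix is `det P̃`** (`= det P̃ · det P̃ᵀ`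
and `x² = x` in `𝔽₂`). [cite: Smith2016CongruentDensity, §2.1 (chunk p0006 L48: "as A is singular, det M = 0 when all the z_i are 0" — the case ℓ = 0)] -/
theorem det_bigN_zero_zero (a : V → V → ZMod 2) (D : Finset V) (ℓ : V → ZMod 2) :
    (bigN a D 0 0 ℓ).det = (lap a D ℓ).det := by
  have h := det_permute (swapCopies D) (bigN a D 0 0 ℓ)
  rw [bigN_zero_zero_submatrix, det_fromBlocks_zero₂₁, det_transpose,
    Literature.LinearAlgebra.QuadraticForm.zmod_two_mul_self] at h
  have hsign : ((Equiv.Perm.sign (swapCopies D) : ℤ) : ZMod 2) = 1 := by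
    rcases Int.units_eq_one_or (Equiv.Perm.sign (swapCopies D)) with h1 | h1 <;> rw [h1] <;> decide
  rw [h, hsign, one_mul]

set_option linter.unusedSimpArgs false in -- shared simp sets across case splits
/-- **Peeling the root copy `inr s` (deletion–contraction).** For `s ∈ D`:
`det N(D) = z s · det (unitize N (inr s)) + ℓ s · det N(D ∖ s; ℓ + a•s)
  + Σ_{j ∈ D ∖ s} a s j · det N^{a/(s→j)}(D ∖ s; y + y s e_j, z, ℓ)`.
Row `inr s` is `z s e_{inr s} + ℓ s e_{inl s} + Σ_j a s j (e_{inl j} + e_{inl s})`; apply the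
symmetric peeling formula, then evaluate the unit border and the contractions.
[cite: Smith2016CongruentDensity, §2.1 Prop. 2.4 (proof: involution expansion of det M₁)] [cite: Chaiken1982, §2 (deletion–contraction)] -/
theorem det_bigN_rec (a : V → V → ZMod 2) {D : Finset V} {s : V} (hs : s ∈ D) (y z ℓ : V → ZMod 2) :
    (bigN a D y z ℓ).det = z s * (unitize (bigN a D y z ℓ) (Sum.inr s)).det +
      ℓ s * (bigN a (D.erase s) y z (fun i => ℓ i + a i s)).det +
      ∑ j ∈ D.erase s, a s j *
        (bigN (contractWt a s j) (D.erase s) (fun i => if i = j then y j + y s else y i) z ℓ).det := by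
  set N := bigN a D y z ℓ with hN
  -- the decomposition of row `inr s`
  set c : V → ZMod 2 := fun α => if α = s then ℓ s else a s α with hc
  set w : V → (V ⊕ V) → ZMod 2 := fun α =>
    if α = s then Pi.single (Sum.inl s) 1 else Pi.single (Sum.inl α) 1 + Pi.single (Sum.inl s) 1
    with hw
  have hwv : ∀ α ∈ D, w α (Sum.inr s) = 0 := by
    intro α _
    simp only [hw]
    split_ifs <;> simp
  have hrow : ∀ J, J ≠ Sum.inr s → N (Sum.inr s) J = ∑ α ∈ D, c α * w α J := by
    intro J hJ
    rcases J with k | k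
    · -- column `inl k`
      rw [hN, bigN_inr_inl, lapIn_apply]
      simp only [hs, true_and]
      by_cases hk : k ∈ D
      · rw [if_pos hk]
        by_cases hsk : s = k
        · subst hsk
          rw [if_pos rfl, ← add_sum_erase _ _ hs]
          simp only [hc, hw, if_true, Pi.single_eq_same, mul_one]
          congr 1
          refine sum_congr rfl fun α hα => ?_
          have hαs : α ≠ s := ne_of_mem_erase hα
          simp [hαs]
        · rw [if_neg hsk, ← add_sum_erase _ _ hk]
          have hks : k ≠ s := fun h => hsk h.symm
          simp only [hc, hw, hks, if_false, Pi.add_apply, Pi.single_eq_same]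
          rw [sum_eq_zero fun α hα => ?_]
          · simp [Ne.symm hks, hsk]
          · have hαk : α ≠ k := ne_of_mem_erase hα
            by_cases hαs : α = s
            · simp [hαs, hsk]
            · simp [hαs, Ne.symm hαk, hsk]
      · rw [if_neg hk]
        refine (sum_eq_zero fun α hα => ?_).symm
        have hαk : α ≠ k := fun h => hk (h ▸ hα)
        have hsk : s ≠ k := fun h => hk (h ▸ hs)
        by_cases hαs : α = s
        · simp [hw, hc, hαs, Ne.symm hsk]
        · simp [hw, hc, hαs, Ne.symm hαk, Ne.symm hsk]
    · -- column `inr k`, `k ≠ s`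
      have hks : k ≠ s := fun h => hJ (by rw [h])
      rw [hN, bigN_inr_inr, if_neg (Ne.symm hks)]
      refine (sum_eq_zero fun α _ => ?_).symm
      by_cases hαs : α = s <;> simp [hw, hαs]
  have hsymm : Nᵀ = N := bigN_transpose a D y z ℓ
  rw [det_eq_peel_of_decomp hsymm (Sum.inr s) D c w hwv hrow, hN, bigN_inr_inr, if_pos rfl,
    if_pos hs, ← add_sum_erase _ _ hs, add_assoc]
  congr 1
  congr 1
  · -- the `ℓ s` term: unit border at `inl s`
    simp only [hc, hw, if_true]
    rw [det_border_single _ (by simp : (Sum.inl s : V ⊕ V) ≠ Sum.inr s),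
      ← det_unitize_unitize _ (by simp : (Sum.inl s : V ⊕ V) ≠ Sum.inr s),
      unitize_unitize_bigN a hs]
  · refine sum_congr rfl fun j hj => ?_
    have hjs : j ≠ s := ne_of_mem_erase hj
    have hjD : j ∈ D := mem_of_mem_erase hj
    simp only [hc, hw, hjs, if_false]
    rw [det_border_single_add_single _ (by simp [hjs] : (Sum.inl j : V ⊕ V) ≠ Sum.inl s)
      (by simp : (Sum.inl j : V ⊕ V) ≠ Sum.inr s) (by simp : (Sum.inl s : V ⊕ V) ≠ Sum.inr s),
      contract_bigN a hs hjD hjs]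

set_option linter.unusedSimpArgs false in -- shared simp sets across case splits
/-- **Peeling the mark copy `inl s` of an unweighted root.** For `s ∈ D`:
`det (unitize N(D) (inr s)) = y s · det N(D ∖ s; ℓ + a•s) + Σ_{k ∈ D ∖ s} a k s · det (unitize N(D ∖ s; ℓ + a•s) (inr k))`
(row `inl s` of the unitized matrix is `y s e_{inl s} + Σ_k a k s e_{inr k}`).
[cite: Smith2016CongruentDensity, §2.1 Prop. 2.5 (proof: the closure of `r + 1`)] [cite: Chaiken1982, §2] -/
theorem det_unitize_bigN_rec (a : V → V → ZMod 2) {D : Finset V} {s : V} (hs : s ∈ D)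
    (y z ℓ : V → ZMod 2) :
    (unitize (bigN a D y z ℓ) (Sum.inr s)).det =
      y s * (bigN a (D.erase s) y z (fun i => ℓ i + a i s)).det +
      ∑ k ∈ D.erase s, a k s *
        (unitize (bigN a (D.erase s) y z (fun i => ℓ i + a i s)) (Sum.inr k)).det := by
  set N := bigN a D y z ℓ with hN
  set N₁ := unitize N (Sum.inr s) with hN₁
  have hsymm : N₁ᵀ = N₁ := by rw [hN₁, unitize_transpose, hN, bigN_transpose]
  set w : V → (V ⊕ V) → ZMod 2 := fun k => Pi.single (Sum.inr k) 1 with hw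
  have hwv : ∀ k ∈ D.erase s, w k (Sum.inl s) = 0 := fun k _ => by simp [hw]
  have hrow : ∀ J, J ≠ Sum.inl s → N₁ (Sum.inl s) J = ∑ k ∈ D.erase s, a k s * w k J := by
    intro J hJ
    rw [hN₁, unitize_apply]
    rcases J with k | k
    · have hks : k ≠ s := fun h => hJ (by rw [h])
      rw [if_neg (by simp), if_neg (by simp), hN, bigN_inl_inl, if_neg (Ne.symm hks)]
      exact (sum_eq_zero fun α _ => by simp [hw]).symm
    · by_cases hks : k = s
      · subst hks
        rw [if_pos rfl, if_neg (by simp)]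
        exact (sum_eq_zero fun α hα => by simp [hw, ne_of_mem_erase hα]).symm
      · rw [if_neg (by simp [hks]), if_neg (by simp), hN, bigN_inl_inr, lapIn_apply]
        simp only [hs, and_true]
        by_cases hk : k ∈ D
        · rw [if_pos hk, if_neg hks, ← add_sum_erase _ _ (mem_erase.mpr ⟨hks, hk⟩)]
          simp only [hw, Pi.single_eq_same, mul_one]
          rw [sum_eq_zero fun α hα => ?_, add_zero]
          have hαk : α ≠ k := ne_of_mem_erase hα
          simp [Ne.symm hαk]
        · rw [if_neg hk]
          refine (sum_eq_zero fun α hα => ?_).symm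
          have hαk : α ≠ k := fun h => hk (h ▸ mem_of_mem_erase hα)
          simp [hw, Ne.symm hαk]
  rw [det_eq_peel_of_decomp hsymm (Sum.inl s) (D.erase s) (fun k => a k s) w hwv hrow]
  have h11 : N₁ (Sum.inl s) (Sum.inl s) = y s := by
    rw [hN₁, unitize_apply, if_neg (by simp), if_neg (by simp), hN, bigN_inl_inl, if_pos rfl, if_pos hs]
  rw [h11]
  congr 1
  · rw [hN₁, unitize_comm, unitize_unitize_bigN a hs]
  · refine sum_congr rfl fun k hk => ?_
    have hks : k ≠ s := ne_of_mem_erase hk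
    simp only [hw]
    rw [det_border_single _ (by simp : (Sum.inr k : V ⊕ V) ≠ Sum.inl s),
      ← det_unitize_unitize _ (by simp : (Sum.inr k : V ⊕ V) ≠ Sum.inl s), hN₁,
      unitize_comm (unitize N (Sum.inr s)) (Sum.inr k) (Sum.inl s), unitize_comm N (Sum.inr s) (Sum.inl s),
      hN, unitize_unitize_bigN a hs]

end Literature.LinearAlgebra.Matrix
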